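import Mathlib
import Summits.ValiantsHypothesis.ValiantsHypothesis.Theses.BarrierLever
import Summits.ValiantsHypothesis.ValiantsHypothesis.Theorems.BarrierLeverParabolicCertificatesDecideTransversal

/-!
# Route BarrierLever — item stmt-ValiantsHypothesis-19690 `ParabolicCertificatesDecideTransversal`,
# route-typed link

Seat val-np-p1 (cell valiant-natproofs, rung V4).  The glue GP ⇒ TT is the tree theorem
`ParabolicCert.parabolicCertificatesDecideTransversal` (p457108, hypothesis = item 19689's signature
verbatim); this file restates it with the type LITERALLY the route decl
`Theses.BarrierLever.ParabolicCertificatesDecideTransversal` so the gate closes item 19690.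

WHAT THIS IS NOT: GP (item 19689) is OPEN; nothing on TT unconditionally, crux 14610, VP vs VNP.
-/

-- layout Summits/ValiantsHypothesis/ValiantsHypothesis forces the duplicated namespace component
set_option linter.dupNamespace false

namespace Summit.ValiantsHypothesis.ValiantsHypothesis.Theorems.BarrierLever.ParabolicCert

/-- **Item stmt-ValiantsHypothesis-19690, route-typed**: `ParabolicCertificatesExist →
TransversalMinorLayoutsNonsingular`. -/
theorem parabolicCertificatesDecideTransversal_route :
    Theses.BarrierLever.ParabolicCertificatesDecideTransversal := by
  unfold Theses.BarrierLever.ParabolicCertificatesDecideTransversal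
  intro GP
  exact parabolicCertificatesDecideTransversal GP

end Summit.ValiantsHypothesis.ValiantsHypothesis.Theorems.BarrierLever.ParabolicCert
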